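import Mathlib.Analysis.Complex.BorelCaratheodory
import Mathlib.Analysis.Complex.BranchLogRoot
import Mathlib.Analysis.Calculus.InverseFunctionTheorem.Deriv
import Mathlib.Analysis.SpecialFunctions.ExpDeriv
import Mathlib.Analysis.Convex.Contractible
import Mathlib.Topology.Algebra.Module.LocallyConvex
import HarnessLib

/-!
# Slow variation of zero-free holomorphic functions of polynomial size (Borel–Carathéodory)

Analytic input for the proof of `Literature.NumberTheory.Transcendental.BrownawellMasser2017_dominantProjection`:
the estimate "`fᵢ(ω + a + x̄) / fᵢ(ω) → 1`" for an algebraic function `fᵢ` on a ball of radius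
`≍ t` around `ω = t v`, `‖a + x̄‖ = O(log t)` (D'Aquino–Fornasiero–Terzo, *Generic solutions of
equations with iterated exponentials*, Trans. AMS 370 (2018), proof of Thm 2.7, where it is read
off the homogeneous leading part of `fᵢ`). We derive it instead from the polynomial upper and
lower bounds `|log ‖fᵢ‖| ≤ M = O(log t)` alone:

* `Literature.NumberTheory.Transcendental.ExpDominant.differentiableOn_of_exp_eq` — a continuous logarithm of a holomorphic function of
  one variable is holomorphic (local inverses of `exp`).
* `Literature.NumberTheory.Transcendental.ExpDominant.norm_div_sub_one_le` — if `y` is holomorphic and zero-free on the ball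
  `B(c, R) ⊆ ℂⁿ` with `|log ‖y‖| ≤ M` there, then `‖y(x)/y(c) - 1‖ ≤ 8 M r / (R - r)` for
  `‖x - c‖ ≤ r`, provided `4 M r ≤ R - r`: take a continuous logarithm `L` of `y` on the (simply
  connected) ball (Mathlib `Complex.exists_continuousOn_eqOn_exp_comp`), restrict to the complex
  line through `c` and `x`, and apply the Borel–Carathéodory inequality (Mathlib
  `Complex.borelCaratheodory_zero`) to `L - L(c)`, whose real part is `log ‖y‖ - log ‖y(c)‖ ≤ 2M`.

## References

* P. D'Aquino, A. Fornasiero, G. Terzo, Trans. Amer. Math. Soc. 370 (2018), §2, Thm 2.7.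
* E. C. Titchmarsh, *The Theory of Functions*, §5.5 (Borel–Carathéodory).
-/

noncomputable section

open Complex Metric Set Filter Topology

namespace Literature.NumberTheory.Transcendental.ExpDominant

/-- **A continuous logarithm of a holomorphic function is holomorphic** (one complex variable):
if `h` is continuous and `k` holomorphic on an open set `s` with `exp ∘ h = k` on `s`, then `h` is
holomorphic on `s` (locally `h = g ∘ k` for a holomorphic local inverse `g` of `exp`). [folklore] -/
theorem differentiableOn_of_exp_eq {s : Set ℂ} (hs : IsOpen s) {h k : ℂ → ℂ}
    (hc : ContinuousOn h s) (hk : DifferentiableOn ℂ k s) (heq : ∀ z ∈ s, exp (h z) = k z) :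
    DifferentiableOn ℂ h s := by
  intro z₀ hz₀
  have hsz : s ∈ 𝓝 z₀ := hs.mem_nhds hz₀
  have hexp : HasStrictDerivAt exp (exp (h z₀)) (h z₀) := Complex.hasStrictDerivAt_exp (h z₀)
  have hne : exp (h z₀) ≠ 0 := exp_ne_zero _
  have hleft := hexp.eventually_left_inverse hne
  have hcont : ContinuousAt h z₀ := hc.continuousAt hsz
  set g := hexp.localInverse exp (exp (h z₀)) (h z₀) hne with hg
  have h1 : ∀ᶠ z in 𝓝 z₀, h z = g (k z) := by
    have := hcont.eventually hleft
    filter_upwards [this, hsz] with z hz hzs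
    rw [← heq z hzs]
    exact hz.symm
  have h2 : DifferentiableAt ℂ (fun z => g (k z)) z₀ := by
    have hgd : DifferentiableAt ℂ g (exp (h z₀)) :=
      (hexp.to_localInverse hne).hasDerivAt.differentiableAt
    rw [heq z₀ hz₀] at hgd
    exact hgd.comp z₀ (hk.differentiableAt hsz)
  exact (h2.congr_of_eventuallyEq h1).differentiableWithinAt

/-- **Slow variation from two-sided polynomial bounds** (Borel–Carathéodory; replaces the
leading-homogeneous-part asymptotics `fᵢ(ω + a + x̄)/fᵢ(ω) → 1` of D'Aquino–Fornasiero–Terzo 2018,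
proof of Thm 2.7). Let `y` be holomorphic and zero-free on the ball `B(c, R)` of `ℂⁿ` (sup norm)
with `|log ‖y‖| ≤ M` there, and let `0 < r < R` with `4 M r ≤ R - r`. Then
`‖y(x) / y(c) - 1‖ ≤ 8 M r / (R - r)` whenever `‖x - c‖ ≤ r`.
[cite: DaquinoFornasieroTerzo2017, Thm 2.7 (proof)] -/
theorem norm_div_sub_one_le {n : ℕ} {c : Fin n → ℂ} {R r M : ℝ} (hr : 0 < r) (hrR : r < R)
    (hM : 0 < M) {y : (Fin n → ℂ) → ℂ} (hy : DifferentiableOn ℂ y (ball c R))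
    (hy0 : ∀ x ∈ ball c R, y x ≠ 0) (hbd : ∀ x ∈ ball c R, |Real.log ‖y x‖| ≤ M)
    (hsmall : 4 * M * r / (R - r) ≤ 1) {x : Fin n → ℂ} (hx : x ∈ closedBall c r) :
    ‖y x / y c - 1‖ ≤ 8 * M * r / (R - r) := by
  have hR : 0 < R := hr.trans hrR
  have hRr : 0 < R - r := by linarith
  -- a continuous logarithm of `y` on the ball
  have hsc : IsSimplyConnected (ball c R) := by
    haveI := (convex_ball c R).contractibleSpace ⟨c, mem_ball_self hR⟩
    exact (inferInstance : SimplyConnectedSpace (ball c R))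
  obtain ⟨Lg, hLgc, hLgexp⟩ := Complex.exists_continuousOn_eqOn_exp_comp hsc isOpen_ball
    hy.continuousOn (by rintro ⟨x', hx', h0⟩; exact hy0 x' hx' h0)
  have hexpLg : ∀ x' ∈ ball c R, exp (Lg x') = y x' := fun x' hx' => hLgexp hx'
  have hre : ∀ x' ∈ ball c R, (Lg x').re = Real.log ‖y x'‖ := fun x' hx' => by
    rw [← hexpLg x' hx', Complex.norm_exp, Real.log_exp]
  -- the complex line through `c` and `x`
  set ℓ : ℂ → (Fin n → ℂ) := fun μ => c + μ • (x - c) with hℓ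
  have hxc : ‖x - c‖ ≤ r := by rwa [mem_closedBall, dist_eq_norm] at hx
  set R' : ℝ := R / r with hR'
  have hR'1 : 1 < R' := by rw [hR', lt_div_iff₀ hr]; linarith
  have hR'pos : 0 < R' := by linarith
  have hℓmem : ∀ μ ∈ ball (0 : ℂ) R', ℓ μ ∈ ball c R := by
    intro μ hμ
    rw [mem_ball, dist_zero_right] at hμ
    rw [mem_ball, dist_eq_norm, hℓ]
    simp only [add_sub_cancel_left, norm_smul]
    calc ‖μ‖ * ‖x - c‖ ≤ ‖μ‖ * r := by gcongr
      _ < R' * r := by gcongr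
      _ = R := by rw [hR']; field_simp
  have hℓcont : Continuous ℓ := by fun_prop
  have hℓdiff : Differentiable ℂ ℓ := fun μ => (differentiableAt_id.smul_const (x - c)).const_add c
  set f : ℂ → ℂ := fun μ => Lg (ℓ μ) - Lg c with hf
  have hf0 : f 0 = 0 := by simp [hf, hℓ]
  have hLgℓ_cont : ContinuousOn (fun μ => Lg (ℓ μ)) (ball 0 R') :=
    hLgc.comp hℓcont.continuousOn hℓmem
  have hyℓ_diff : DifferentiableOn ℂ (fun μ => y (ℓ μ)) (ball 0 R') :=
    hy.comp hℓdiff.differentiableOn hℓmem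
  have hLgℓ_diff : DifferentiableOn ℂ (fun μ => Lg (ℓ μ)) (ball 0 R') :=
    differentiableOn_of_exp_eq isOpen_ball hLgℓ_cont hyℓ_diff fun μ hμ => hexpLg _ (hℓmem μ hμ)
  have hfdiff : DifferentiableOn ℂ f (ball 0 R') := hLgℓ_diff.sub_const _
  have hfre : MapsTo f (ball 0 R') {z | z.re ≤ 2 * M} := by
    intro μ hμ
    simp only [mem_setOf_eq, hf, sub_re]
    rw [hre _ (hℓmem μ hμ), hre c (mem_ball_self hR)]
    have h1 := hbd _ (hℓmem μ hμ)
    have h2 := hbd c (mem_ball_self hR)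
    rw [abs_le] at h1 h2
    linarith
  have h1mem : (1 : ℂ) ∈ ball (0 : ℂ) R' := by simpa using hR'1
  have hBC := Complex.borelCaratheodory_zero (by positivity : (0 : ℝ) < 2 * M) hfdiff hfre hR'pos
    h1mem hf0
  have hf1 : ‖f 1‖ ≤ 4 * M * r / (R - r) := by
    rw [norm_one, mul_one] at hBC
    have e : R' - 1 = (R - r) / r := by rw [hR']; field_simp
    rw [e] at hBC
    calc ‖f 1‖ ≤ 2 * (2 * M) / ((R - r) / r) := hBC
      _ = 4 * M * r / (R - r) := by field_simp; ring
  have hℓ1 : ℓ 1 = x := by simp [hℓ]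
  have hxball : x ∈ ball c R := hℓ1 ▸ hℓmem 1 h1mem
  have hquot : y x / y c = exp (f 1) := by
    simp only [hf, hℓ1]
    rw [exp_sub, hexpLg x hxball, hexpLg c (mem_ball_self hR)]
  rw [hquot]
  calc ‖exp (f 1) - 1‖ ≤ 2 * ‖f 1‖ := Complex.norm_exp_sub_one_le (hf1.trans hsmall)
    _ ≤ 2 * (4 * M * r / (R - r)) := by gcongr
    _ = 8 * M * r / (R - r) := by ring

end Literature.NumberTheory.Transcendental.ExpDominant
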